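import Literature.AlgebraicGeometry.HodgeTheory.HodgeStructureOfHodgeModelTypeShift
import HarnessLib

/-!
# Rational maps of INTEGER bidegree `(r, r)` (any sign) on the cohomology of smooth projective varieties are the morphisms of `ℚ`-Hodge structures into the Tate twist `H(r)`, `r : ℤ`
# (Voisin I §7.3.1 Def. 7.22, §7.3.2; Deligne 1971 1.2.5, 2.1.13–2.1.14)

Family `hodge`, lane `lit-hodgefound` (Track 2 foundations library; Layer A1), layer `Literature/AlgebraicGeometry/HodgeTheory`.  THEOREMS ONLY (no definition, no named fact, no instance; D-0026 net
debt `0`).  The tree's `HodgeStructureOfHodgeModelTypeShift` passes between the two descriptions of a morphism of Hodge structures OF TYPE `(r, r)` (Voisin I Def. 7.22) — (i) a `ℂ`-linear map of the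
carriers `f : Hᵃ(X(ℂ);ℂ) → Hᵇ(Y(ℂ);ℂ)`, `b = a + 2r`, mapping rational classes to rational classes and classes of type `(p, q)` (read in a Hodge model `A` of `X`) to classes of type `(p + r, q + r)`
(read in a Hodge model `B` of `Y`); (ii) a genuine morphism of the `ℚ`-Hodge structures of the models `A.hodgeStructure a ⟶ (B.hodgeStructure b)(r)` into the Tate twist — for NON-NEGATIVE `r : ℕ`
only.  Morphisms of negative type are just as common (the inverse Lefschetz isomorphisms `H^{n+k} ⥲ H^{n−k}` are of type `(−k, −k)`; the action `Hᵃ(Z;ℂ) → Hⁱ(Y;ℂ)` of a Hodge class of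
`H^{2c}(Y × Z)` is of type `(c − n, c − n)`, negative when `c < n = dim Z` — e.g. `H³(T) → H¹(C)(−1)` on a curve times a threefold), and Deligne's Tate twist `H(r)` is defined for every `r : ℤ`
(`HodgeStructure.tateTwist`, `piece_tateTwist`: `H(r)^{p,q} = H^{p+r,q+r}`).  This file proves the passage for EVERY `r : ℤ`.  For negative `r` a type `(p, q)` with `p + r < 0` or `q + r < 0` has
no image type, and the carrier condition acquires the clause «`f` kills the classes of those types» — exactly the shape of the tree's `exists_hodgeClass_corrAction_eq_smul_of_shift` /
`BettiUniverse.…_typeShift` binders (`hS`/`hV`), which are thereby identified with morphisms of Hodge structures into `H(r)` for all signs.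

WHAT IS PROVED.
* §0 **`HodgeModel.hodgeStructure_piece_eq_bot_of_neg`** — the pieces `V^{P,Q}` of `A.hodgeStructure a` with `P < 0` or `Q < 0` vanish (the models' Hodge structures are effective).
* §1 carriers ⟹ abstract, any sign: **`HodgeModel.exists_hom_of_typeShift_int`** — a `ℂ`-linear `f : Hᵃ(X(ℂ);ℂ) → Hᵇ(Y(ℂ);ℂ)`, `a + 2r = b` (`r : ℤ`), mapping rational classes to rational classes, type
  `(p, q)` to type `(p + r, q + r)` whenever `p + r, q + r ≥ 0`, and killing type `(p, q)` when `p + r < 0` or `q + r < 0`, underlies a morphism `A.hodgeStructure a ⟶ T` into any Hodge structure `T`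
  of weight `a` on `Hᵇ(Y(ℂ);ℚ)` with `T^{p,q} = (B.hodgeStructure b)^{p+r,q+r}` (the twist `(B.hodgeStructure b)(r)` transported to weight `a`, §3), with `β_Y ∘ φ_ℂ = f ∘ β_X` (`β = ofRatClassBaseChange`).
* §2 abstract ⟹ carriers, any sign: **`HodgeModel.typeShift_of_hom_int`** (the carrier map of such a morphism is rational, shifts types by `(r, r)` and kills the types without image type) and
  **`HodgeModel.exists_carrier_of_hom_int`** (the carrier map `β_Y ∘ φ_ℂ ∘ β_X⁻¹` packaged).
* §3 **`HodgeModel.piece_tateTwist_cast_int`** — the pieces of `((B.hodgeStructure b).tateTwist r).cast _` for `r : ℤ` (the hypothesis `hT`).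
* §4 NEGATIVE TYPE in natural-number arithmetic (`r = −k`, `b + 2k = a`; types `(p' + k, q' + k) ↦ (p', q')`, the types with `p < k` or `q < k` killed): **`HodgeModel.exists_hom_of_typeShift_sub`**,
  **`HodgeModel.typeShift_of_hom_sub`**, **`HodgeModel.exists_carrier_of_hom_sub`**, **`HodgeModel.piece_tateTwist_cast_sub`**.
* §5 DIFFERENCE TYPE `(c − n, c − n)` for naturals `c`, `n` (the binder shape `p' + n = p + c`, `p + c < n ∨ q + c < n` of the tree's correspondence-action lemmas): **`HodgeModel.exists_hom_of_typeShift_of_add_eq`**,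
  **`HodgeModel.typeShift_of_hom_of_add_eq`**, **`HodgeModel.exists_carrier_of_hom_of_add_eq`**.

THE PRINTS.  C. Voisin (2002) [VoisinHodgeI2002] §7.1.1; §7.3.1 Def. 7.22 («A morphism of Hodge structures of type (r, r) … is a morphism φ : V_ℚ → W_ℚ such that φ_ℂ(V^{p,q}) ⊂ W^{p+r,q+r}»); §7.3.2
(the Tate twist makes a morphism of type `(r, r)` a morphism of Hodge structures).  P. Deligne (1971) [DeligneHodgeII1971] 1.2.5 (pieces off the line vanish), 2.1.13–2.1.14 (`ℚ(r)`, `H(r) = H ⊗ ℚ(r)`,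
`H(r)^{p,q} = H^{p+r,q+r}`, any `r ∈ ℤ`).

THE OBJECTS (all the tree's).  `HodgeModel`, `HodgeModel.hodgeStructure`, `HodgeModel.pullback`, `HodgeModel.hodgePQ`, `HodgeModel.ratPiece`, `HodgeModel.ratF`, `Motives.HodgeStructure.Hom`, `tateTwist`, `cast`, `piece`,
`IsRationalClass`, `Motives.ofRatClassBaseChange`, `ofRatClassBaseChangeEquiv`; the tree's `exists_ratLinearMap_ofRatClass_eq`, `Motives.HodgeStructure.Hom.exists_of_mapPieceLe`, `HodgeModel.piece_eq_ratPiece`,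
`HodgeModel.ratF_eq_bot`, `ofRatClassBaseChange_injective`, `ofRatClassBaseChange_surjective`.

DEVIATIONS / SCOPE.  None beyond the tree's setting (smooth projective `X`, `Y`, Hodge-symmetric models).  The non-negative file `HodgeStructureOfHodgeModelTypeShift` is the case `r : ℕ` (there the
killing clause is vacuous).  No definitions.

## References
* [VoisinHodgeI2002] C. Voisin, *Hodge Theory and Complex Algebraic Geometry I* (2002) — §7.1.1; §7.3.1 Def. 7.22; §7.3.2.
* [DeligneHodgeII1971] P. Deligne, *Théorie de Hodge II* (1971) — 1.2.5, 2.1.13–2.1.14.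

## Provenance
Lane `lit-hodgefound` (Hodge path, Track 2), prover seat `lit-hodgefound-p29` (generation 31), self-proposed row g31-#1 (gen-30 free pointer (a): integer bidegree for the carriers ⟷ `Hom_HS`
dictionary, prerequisite of the negative-bidegree packaging of Lemma 11.41).
-/

noncomputable section

open scoped TensorProduct
open CategoryTheory AlgebraicGeometry
open Literature.AlgebraicTopology.SingularHomology

namespace Literature.AlgebraicGeometry.HodgeTheory

section HodgeTheory

variable {n m : ℕ} {X Y : Motives.SchemeOver ℂ}

/-! ### §0 The models' Hodge structures are effective -/

/-- **The pieces `V^{P,Q}` of `A.hodgeStructure a` with `P < 0` or `Q < 0` vanish**: off the line `P + Q = a` by definition; on it, `Q > a` (resp. `P > a`) and `F^Q = 0` (resp. `F^P = 0`),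
`ratF_eq_bot`. [cite: DeligneHodgeII1971, 1.2.5] [cite: VoisinHodgeI2002, §7.1.1] -/
theorem HodgeModel.hodgeStructure_piece_eq_bot_of_neg (hX : Motives.IsSmoothProjective n X) (A : HodgeModel n X) (hA : A.IsHodgeSymmetric) (a : ℕ) {P Q : ℤ}
    (h : P < 0 ∨ Q < 0) : (A.hodgeStructure hX hA a).piece P Q = ⊥ := by
  by_cases hPQ : P + Q = ((a : ℕ) : ℤ)
  swap
  · exact Motives.HodgeStructure.piece_eq_bot_of_add_ne _ hPQ
  rw [Submodule.eq_bot_iff]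
  intro x hx
  rw [Motives.HodgeStructure.mem_piece_iff _ hPQ, HodgeModel.hodgeStructure_F, HodgeModel.hodgeStructure_F] at hx
  rcases h with hP | hQ
  · rw [A.ratF_eq_bot hX a (show ((a : ℕ) : ℤ) < Q by omega), Submodule.mem_bot] at hx
    have h2 := congrArg Motives.HodgeStructure.conj hx.2
    rwa [Motives.HodgeStructure.conj_conj, map_zero] at h2
  · rw [A.ratF_eq_bot hX a (show ((a : ℕ) : ℤ) < P by omega), Submodule.mem_bot] at hx
    exact hx.1

/-! ### §1 Carriers ⟹ abstract, any sign of the bidegree -/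

/-- **A rational map of integer bidegree `(r, r)` on the carriers is a morphism of the Hodge structures of the models into the Tate twist by `r : ℤ`** (Voisin I Def. 7.22 / §7.3.2; Deligne 2.1.14).
Let `X`, `Y` be smooth projective with Hodge-symmetric models `A`, `B`, `f : Hᵃ(X(ℂ);ℂ) → Hᵇ(Y(ℂ);ℂ)` `ℂ`-linear with `a + 2r = b`, mapping rational classes to rational classes, classes whose
`A`-pull-back lies in `H^{p,q}` (`p + q = a`) to classes whose `B`-pull-back lies in `H^{p',q'}` whenever `p' = p + r ≥ 0`, `q' = q + r ≥ 0`, and to `0` when `p + r < 0` or `q + r < 0`.  Then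
the restriction of `f` to the rational lattices underlies a morphism `A.hodgeStructure a ⟶ T` into any weight-`a` Hodge structure `T` on `Hᵇ(Y(ℂ);ℚ)` with pieces `T^{p,q} = (B.hodgeStructure b)^{p+r,q+r}`,
and `β_Y ∘ (φ ⊗ ℂ) = f ∘ β_X`. [cite: VoisinHodgeI2002, §7.3.1 Def. 7.22 and §7.3.2] [cite: DeligneHodgeII1971, 2.1.13–2.1.14] -/
theorem HodgeModel.exists_hom_of_typeShift_int (hX : Motives.IsSmoothProjective n X)
    (hY : Motives.IsSmoothProjective m Y) (A : HodgeModel n X) (hA : A.IsHodgeSymmetric)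
    (B : HodgeModel m Y) (hB : B.IsHodgeSymmetric) {a b : ℕ} {r : ℤ} (hab : ((a : ℕ) : ℤ) + 2 * r = ((b : ℕ) : ℤ))
    (T : Motives.HodgeStructure (Motives.bettiCohomology Y b) ((a : ℕ) : ℤ))
    (hT : ∀ p q : ℤ, T.piece p q = (B.hodgeStructure hY hB b).piece (p + r) (q + r))
    (f : complexBetti X a →ₗ[ℂ] complexBetti Y b) (hf : ∀ c, IsRationalClass c → IsRationalClass (f c))
    (hfH : ∀ (p q : ℕ), p + q = a → ∀ c, A.pullback a c ∈ A.hodgePQ a p q →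
      ∀ p' q' : ℕ, ((p : ℕ) : ℤ) + r = ((p' : ℕ) : ℤ) → ((q : ℕ) : ℤ) + r = ((q' : ℕ) : ℤ) → B.pullback b (f c) ∈ B.hodgePQ b p' q')
    (hf0 : ∀ (p q : ℕ), p + q = a → ∀ c, A.pullback a c ∈ A.hodgePQ a p q →
      ((p : ℕ) : ℤ) + r < 0 ∨ ((q : ℕ) : ℤ) + r < 0 → f c = 0) :
    ∃ φ : Motives.HodgeStructure.Hom (A.hodgeStructure hX hA a) T,
      ∀ x, Motives.ofRatClassBaseChange (Motives.ComplexPoints Y) b (φ.toLinearMap.baseChange ℂ x) =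
        f (Motives.ofRatClassBaseChange (Motives.ComplexPoints X) a x) := by
  classical
  obtain ⟨fq, hfq⟩ := exists_ratLinearMap_ofRatClass_eq f hf
  -- `β_Y ∘ (fq ⊗ ℂ) = f ∘ β_X`
  have hcomm : ∀ x, Motives.ofRatClassBaseChange (Motives.ComplexPoints Y) b (fq.baseChange ℂ x) =
      f (Motives.ofRatClassBaseChange (Motives.ComplexPoints X) a x) := by
    intro x
    induction x using TensorProduct.induction_on with
    | zero => simp only [map_zero]
    | tmul c v =>
      rw [LinearMap.baseChange_tmul, Motives.ofRatClassBaseChange_tmul, Motives.ofRatClassBaseChange_tmul,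
        map_smul, hfq]
    | add x y hx hy => simp only [map_add, hx, hy]
  suffices hpiece : ∀ P Q : ℤ, P + Q = ((a : ℕ) : ℤ) →
      ((A.hodgeStructure hX hA a).piece P Q).map (fq.baseChange ℂ) ≤ T.piece P Q by
    obtain ⟨φ, hφ⟩ := Motives.HodgeStructure.Hom.exists_of_mapPieceLe _ _ fq hpiece
    exact ⟨φ, fun x ↦ by rw [hφ]; exact hcomm x⟩
  intro P Q hPQ
  rintro _ ⟨x, hx, rfl⟩
  rw [SetLike.mem_coe] at hx
  -- off the effective range the source piece vanishes
  by_cases hP : 0 ≤ P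
  swap
  · rw [HodgeModel.hodgeStructure_piece_eq_bot_of_neg hX A hA a (Or.inl (lt_of_not_ge hP)), Submodule.mem_bot] at hx
    rw [hx, map_zero]
    exact Submodule.zero_mem _
  by_cases hQ : 0 ≤ Q
  swap
  · rw [HodgeModel.hodgeStructure_piece_eq_bot_of_neg hX A hA a (Or.inr (lt_of_not_ge hQ)), Submodule.mem_bot] at hx
    rw [hx, map_zero]
    exact Submodule.zero_mem _
  -- `P = p`, `Q = q` naturals with `p + q = a`
  obtain ⟨p, rfl⟩ : ∃ p : ℕ, (p : ℤ) = P := ⟨P.toNat, Int.toNat_of_nonneg hP⟩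
  obtain ⟨q, rfl⟩ : ∃ q : ℕ, (q : ℤ) = Q := ⟨Q.toNat, Int.toNat_of_nonneg hQ⟩
  have hpq : p + q = a := by omega
  rw [A.piece_eq_ratPiece hX hA hpq, HodgeModel.mem_ratPiece_iff, HodgeModel.complexification_apply] at hx
  rw [hT]
  by_cases hlt : ((p : ℕ) : ℤ) + r < 0 ∨ ((q : ℕ) : ℤ) + r < 0
  · -- no image type: `f` kills the class, so `fq ⊗ ℂ` kills `x` (`β_Y` injective)
    have h0 : f (Motives.ofRatClassBaseChange (Motives.ComplexPoints X) a x) = 0 := hf0 p q hpq _ hx hlt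
    have hx0 : fq.baseChange ℂ x = 0 := by
      apply ofRatClassBaseChange_injective (Y := Motives.ComplexPoints Y) b
      rw [hcomm, h0, map_zero]
    rw [hx0]
    exact Submodule.zero_mem _
  · -- the image type `(p', q') = (p + r, q + r)` is a genuine type of weight `b`
    obtain ⟨hp0, hq0⟩ := not_or.1 hlt
    obtain ⟨p', hp'⟩ : ∃ p' : ℕ, ((p : ℕ) : ℤ) + r = ((p' : ℕ) : ℤ) := ⟨(((p : ℕ) : ℤ) + r).toNat, (Int.toNat_of_nonneg (le_of_not_gt hp0)).symm⟩
    obtain ⟨q', hq'⟩ : ∃ q' : ℕ, ((q : ℕ) : ℤ) + r = ((q' : ℕ) : ℤ) := ⟨(((q : ℕ) : ℤ) + r).toNat, (Int.toNat_of_nonneg (le_of_not_gt hq0)).symm⟩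
    rw [hp', hq', B.piece_eq_ratPiece hY hB (show p' + q' = b by omega), HodgeModel.mem_ratPiece_iff,
      HodgeModel.complexification_apply, hcomm]
    exact hfH p q hpq _ hx p' q' hp' hq'

/-! ### §2 Abstract ⟹ carriers, any sign of the bidegree -/

/-- **Conversely, a morphism `A.hodgeStructure a ⟶ (B.hodgeStructure b)(r)`, `r : ℤ`, is a rational map of bidegree `(r, r)` on the carriers which kills the types without image type**: if
`β_Y ∘ (φ ⊗ ℂ) = f ∘ β_X`, then `f` maps rational classes to rational classes, classes of type `(p, q)` in `A` to classes of type `(p + r, q + r)` in `B` when `p + r, q + r ≥ 0`, and to `0` when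
`p + r < 0` or `q + r < 0` (`Hom.map_piece_le`, `piece_eq_ratPiece`, the vanishing §0 of the target piece). [cite: VoisinHodgeI2002, §7.3.1 Def. 7.22 and §7.3.2] [cite: DeligneHodgeII1971, 1.2.5, 2.1.13–2.1.14] -/
theorem HodgeModel.typeShift_of_hom_int (hX : Motives.IsSmoothProjective n X)
    (hY : Motives.IsSmoothProjective m Y) (A : HodgeModel n X) (hA : A.IsHodgeSymmetric)
    (B : HodgeModel m Y) (hB : B.IsHodgeSymmetric) {a b : ℕ} {r : ℤ} (hab : ((a : ℕ) : ℤ) + 2 * r = ((b : ℕ) : ℤ))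
    (T : Motives.HodgeStructure (Motives.bettiCohomology Y b) ((a : ℕ) : ℤ))
    (hT : ∀ p q : ℤ, T.piece p q = (B.hodgeStructure hY hB b).piece (p + r) (q + r))
    (φ : Motives.HodgeStructure.Hom (A.hodgeStructure hX hA a) T)
    (f : complexBetti X a →ₗ[ℂ] complexBetti Y b)
    (hf : ∀ x, Motives.ofRatClassBaseChange (Motives.ComplexPoints Y) b (φ.toLinearMap.baseChange ℂ x) =
      f (Motives.ofRatClassBaseChange (Motives.ComplexPoints X) a x)) :
    (∀ c, IsRationalClass c → IsRationalClass (f c)) ∧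
      (∀ (p q : ℕ), p + q = a → ∀ c, A.pullback a c ∈ A.hodgePQ a p q →
        ∀ p' q' : ℕ, ((p : ℕ) : ℤ) + r = ((p' : ℕ) : ℤ) → ((q : ℕ) : ℤ) + r = ((q' : ℕ) : ℤ) → B.pullback b (f c) ∈ B.hodgePQ b p' q') ∧
      (∀ (p q : ℕ), p + q = a → ∀ c, A.pullback a c ∈ A.hodgePQ a p q →
        ((p : ℕ) : ℤ) + r < 0 ∨ ((q : ℕ) : ℤ) + r < 0 → f c = 0) := by
  have hβX := ofRatClassBaseChange_surjective hX a
  -- the image of a class of type `(p, q)` lies in the target piece `(p + r, q + r)`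
  have key : ∀ (p q : ℕ), p + q = a → ∀ x, A.pullback a (Motives.ofRatClassBaseChange (Motives.ComplexPoints X) a x) ∈ A.hodgePQ a p q →
      φ.toLinearMap.baseChange ℂ x ∈ (B.hodgeStructure hY hB b).piece (((p : ℕ) : ℤ) + r) (((q : ℕ) : ℤ) + r) := by
    intro p q hpq x hx
    have hxp : x ∈ (A.hodgeStructure hX hA a).piece p q := by
      rw [A.piece_eq_ratPiece hX hA hpq, HodgeModel.mem_ratPiece_iff, HodgeModel.complexification_apply]
      exact hx
    rw [← hT]
    exact φ.map_piece_le p q ⟨x, hxp, rfl⟩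
  refine ⟨?_, ?_, ?_⟩
  · intro c hc
    obtain ⟨v, rfl⟩ := (isRationalClass_iff_mem_range_ofRatClass c).1 hc
    rw [← ofRatClassBaseChange_ofRat, ← hf, Motives.HodgeStructure.baseChange_ofRat,
      ofRatClassBaseChange_ofRat]
    exact isRationalClass_ofRatClass _
  · intro p q hpq c hc p' q' hp' hq'
    obtain ⟨x, rfl⟩ := hβX c
    have hφx := key p q hpq x hc
    rw [hp', hq', B.piece_eq_ratPiece hY hB (show p' + q' = b by omega), HodgeModel.mem_ratPiece_iff,
      HodgeModel.complexification_apply, hf] at hφx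
    exact hφx
  · intro p q hpq c hc hlt
    obtain ⟨x, rfl⟩ := hβX c
    have hφx := key p q hpq x hc
    rw [HodgeModel.hodgeStructure_piece_eq_bot_of_neg hY B hB b hlt, Submodule.mem_bot] at hφx
    rw [← hf, hφx, map_zero]

/-- The carrier map of a morphism `A.hodgeStructure a ⟶ (B.hodgeStructure b)(r)`, `r : ℤ`: `β_Y ∘ (φ ⊗ ℂ) ∘ β_X⁻¹`, with its defining compatibility and its three carrier properties.
[cite: VoisinHodgeI2002, §7.3.2] [cite: DeligneHodgeII1971, 2.1.13–2.1.14] -/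
theorem HodgeModel.exists_carrier_of_hom_int (hX : Motives.IsSmoothProjective n X)
    (hY : Motives.IsSmoothProjective m Y) (A : HodgeModel n X) (hA : A.IsHodgeSymmetric)
    (B : HodgeModel m Y) (hB : B.IsHodgeSymmetric) {a b : ℕ} {r : ℤ} (hab : ((a : ℕ) : ℤ) + 2 * r = ((b : ℕ) : ℤ))
    (T : Motives.HodgeStructure (Motives.bettiCohomology Y b) ((a : ℕ) : ℤ))
    (hT : ∀ p q : ℤ, T.piece p q = (B.hodgeStructure hY hB b).piece (p + r) (q + r))
    (φ : Motives.HodgeStructure.Hom (A.hodgeStructure hX hA a) T) :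
    ∃ f : complexBetti X a →ₗ[ℂ] complexBetti Y b,
      (∀ x, Motives.ofRatClassBaseChange (Motives.ComplexPoints Y) b (φ.toLinearMap.baseChange ℂ x) =
        f (Motives.ofRatClassBaseChange (Motives.ComplexPoints X) a x)) ∧
      (∀ c, IsRationalClass c → IsRationalClass (f c)) ∧
      (∀ (p q : ℕ), p + q = a → ∀ c, A.pullback a c ∈ A.hodgePQ a p q →
        ∀ p' q' : ℕ, ((p : ℕ) : ℤ) + r = ((p' : ℕ) : ℤ) → ((q : ℕ) : ℤ) + r = ((q' : ℕ) : ℤ) → B.pullback b (f c) ∈ B.hodgePQ b p' q') ∧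
      (∀ (p q : ℕ), p + q = a → ∀ c, A.pullback a c ∈ A.hodgePQ a p q →
        ((p : ℕ) : ℤ) + r < 0 ∨ ((q : ℕ) : ℤ) + r < 0 → f c = 0) := by
  set f : complexBetti X a →ₗ[ℂ] complexBetti Y b :=
    (ofRatClassBaseChangeEquiv hY b).toLinearMap ∘ₗ (φ.toLinearMap.baseChange ℂ) ∘ₗ
      (ofRatClassBaseChangeEquiv hX a).symm.toLinearMap with hfdef
  have hf : ∀ x, Motives.ofRatClassBaseChange (Motives.ComplexPoints Y) b (φ.toLinearMap.baseChange ℂ x) =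
      f (Motives.ofRatClassBaseChange (Motives.ComplexPoints X) a x) := by
    intro x
    rw [hfdef, LinearMap.comp_apply, LinearMap.comp_apply, ← ofRatClassBaseChangeEquiv_apply hX a,
      LinearEquiv.coe_toLinearMap, LinearEquiv.coe_toLinearMap, LinearEquiv.symm_apply_apply,
      ofRatClassBaseChangeEquiv_apply]
  exact ⟨f, hf, HodgeModel.typeShift_of_hom_int hX hY A hA B hB hab T hT φ f hf⟩

/-! ### §3 The pieces of the integer Tate twist transported to weight `a` -/

/-- The pieces of `(B.hodgeStructure hY hB b)(r)` transported to weight `a = b − 2r`, for any `r : ℤ`: the hypothesis `hT` of §1–§2 for the twisted target. [cite: DeligneHodgeII1971, 2.1.13–2.1.14] -/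
theorem HodgeModel.piece_tateTwist_cast_int (hY : Motives.IsSmoothProjective m Y) (B : HodgeModel m Y)
    (hB : B.IsHodgeSymmetric) {a b : ℕ} {r : ℤ} (hw : ((b : ℕ) : ℤ) - 2 * r = ((a : ℕ) : ℤ)) (p q : ℤ) :
    (((B.hodgeStructure hY hB b).tateTwist r).cast hw).piece p q =
      (B.hodgeStructure hY hB b).piece (p + r) (q + r) := by
  rw [Motives.HodgeStructure.cast_piece, Motives.piece_tateTwist]

/-! ### §4 Negative type `(−k, −k)` in natural-number arithmetic -/

/-- **A rational map of type `(−k, −k)` on the carriers — `f : Hᵃ(X(ℂ);ℂ) → Hᵇ(Y(ℂ);ℂ)`, `b + 2k = a`, type `(p' + k, q' + k) ↦ (p', q')`, the types with `p < k` or `q < k` killed — is a morphism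
`A.hodgeStructure a ⟶ (B.hodgeStructure b)(−k)`** (§1 with `r = −k`). [cite: VoisinHodgeI2002, §7.3.1 Def. 7.22 and §7.3.2] [cite: DeligneHodgeII1971, 2.1.13–2.1.14] -/
theorem HodgeModel.exists_hom_of_typeShift_sub (hX : Motives.IsSmoothProjective n X)
    (hY : Motives.IsSmoothProjective m Y) (A : HodgeModel n X) (hA : A.IsHodgeSymmetric)
    (B : HodgeModel m Y) (hB : B.IsHodgeSymmetric) {a b k : ℕ} (hab : b + 2 * k = a)
    (T : Motives.HodgeStructure (Motives.bettiCohomology Y b) ((a : ℕ) : ℤ))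
    (hT : ∀ p q : ℤ, T.piece p q = (B.hodgeStructure hY hB b).piece (p - k) (q - k))
    (f : complexBetti X a →ₗ[ℂ] complexBetti Y b) (hf : ∀ c, IsRationalClass c → IsRationalClass (f c))
    (hfH : ∀ (p' q' : ℕ), p' + q' = b → ∀ c, A.pullback a c ∈ A.hodgePQ a (p' + k) (q' + k) → B.pullback b (f c) ∈ B.hodgePQ b p' q')
    (hf0 : ∀ (p q : ℕ), p + q = a → ∀ c, A.pullback a c ∈ A.hodgePQ a p q → p < k ∨ q < k → f c = 0) :
    ∃ φ : Motives.HodgeStructure.Hom (A.hodgeStructure hX hA a) T,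
      ∀ x, Motives.ofRatClassBaseChange (Motives.ComplexPoints Y) b (φ.toLinearMap.baseChange ℂ x) =
        f (Motives.ofRatClassBaseChange (Motives.ComplexPoints X) a x) := by
  refine HodgeModel.exists_hom_of_typeShift_int hX hY A hA B hB (r := -((k : ℕ) : ℤ)) (by omega) T (fun p q ↦ by rw [hT, sub_eq_add_neg, sub_eq_add_neg]) f hf
    (fun p q hpq c hc p' q' hp' hq' ↦ ?_) (fun p q hpq c hc hlt ↦ hf0 p q hpq c hc (by omega))
  obtain rfl : p = p' + k := by omega
  obtain rfl : q = q' + k := by omega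
  exact hfH p' q' (by omega) c hc

/-- **Conversely a morphism `A.hodgeStructure a ⟶ (B.hodgeStructure b)(−k)` is a rational map of type `(−k, −k)` on the carriers, killing the types with `p < k` or `q < k`** (§2 with `r = −k`).
[cite: VoisinHodgeI2002, §7.3.1 Def. 7.22 and §7.3.2] [cite: DeligneHodgeII1971, 1.2.5, 2.1.13–2.1.14] -/
theorem HodgeModel.typeShift_of_hom_sub (hX : Motives.IsSmoothProjective n X)
    (hY : Motives.IsSmoothProjective m Y) (A : HodgeModel n X) (hA : A.IsHodgeSymmetric)
    (B : HodgeModel m Y) (hB : B.IsHodgeSymmetric) {a b k : ℕ} (hab : b + 2 * k = a)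
    (T : Motives.HodgeStructure (Motives.bettiCohomology Y b) ((a : ℕ) : ℤ))
    (hT : ∀ p q : ℤ, T.piece p q = (B.hodgeStructure hY hB b).piece (p - k) (q - k))
    (φ : Motives.HodgeStructure.Hom (A.hodgeStructure hX hA a) T)
    (f : complexBetti X a →ₗ[ℂ] complexBetti Y b)
    (hf : ∀ x, Motives.ofRatClassBaseChange (Motives.ComplexPoints Y) b (φ.toLinearMap.baseChange ℂ x) =
      f (Motives.ofRatClassBaseChange (Motives.ComplexPoints X) a x)) :
    (∀ c, IsRationalClass c → IsRationalClass (f c)) ∧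
      (∀ (p' q' : ℕ), p' + q' = b → ∀ c, A.pullback a c ∈ A.hodgePQ a (p' + k) (q' + k) → B.pullback b (f c) ∈ B.hodgePQ b p' q') ∧
      (∀ (p q : ℕ), p + q = a → ∀ c, A.pullback a c ∈ A.hodgePQ a p q → p < k ∨ q < k → f c = 0) := by
  obtain ⟨hR, hS, hV⟩ := HodgeModel.typeShift_of_hom_int hX hY A hA B hB (r := -((k : ℕ) : ℤ)) (by omega) T
    (fun p q ↦ by rw [hT, sub_eq_add_neg, sub_eq_add_neg]) φ f hf
  exact ⟨hR, fun p' q' hpq c hc ↦ hS (p' + k) (q' + k) (by omega) c hc p' q' (by push_cast; ring) (by push_cast; ring),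
    fun p q hpq c hc hlt ↦ hV p q hpq c hc (by omega)⟩

/-- The carrier map of a morphism `A.hodgeStructure a ⟶ (B.hodgeStructure b)(−k)` packaged (§2 with `r = −k`). [cite: VoisinHodgeI2002, §7.3.2] -/
theorem HodgeModel.exists_carrier_of_hom_sub (hX : Motives.IsSmoothProjective n X)
    (hY : Motives.IsSmoothProjective m Y) (A : HodgeModel n X) (hA : A.IsHodgeSymmetric)
    (B : HodgeModel m Y) (hB : B.IsHodgeSymmetric) {a b k : ℕ} (hab : b + 2 * k = a)
    (T : Motives.HodgeStructure (Motives.bettiCohomology Y b) ((a : ℕ) : ℤ))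
    (hT : ∀ p q : ℤ, T.piece p q = (B.hodgeStructure hY hB b).piece (p - k) (q - k))
    (φ : Motives.HodgeStructure.Hom (A.hodgeStructure hX hA a) T) :
    ∃ f : complexBetti X a →ₗ[ℂ] complexBetti Y b,
      (∀ x, Motives.ofRatClassBaseChange (Motives.ComplexPoints Y) b (φ.toLinearMap.baseChange ℂ x) =
        f (Motives.ofRatClassBaseChange (Motives.ComplexPoints X) a x)) ∧
      (∀ c, IsRationalClass c → IsRationalClass (f c)) ∧
      (∀ (p' q' : ℕ), p' + q' = b → ∀ c, A.pullback a c ∈ A.hodgePQ a (p' + k) (q' + k) → B.pullback b (f c) ∈ B.hodgePQ b p' q') ∧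
      (∀ (p q : ℕ), p + q = a → ∀ c, A.pullback a c ∈ A.hodgePQ a p q → p < k ∨ q < k → f c = 0) := by
  obtain ⟨f, hf, -⟩ := HodgeModel.exists_carrier_of_hom_int hX hY A hA B hB (r := -((k : ℕ) : ℤ)) (by omega) T
    (fun p q ↦ by rw [hT, sub_eq_add_neg, sub_eq_add_neg]) φ
  exact ⟨f, hf, HodgeModel.typeShift_of_hom_sub hX hY A hA B hB hab T hT φ f hf⟩

/-- The pieces of `(B.hodgeStructure hY hB b)(−k)` transported to weight `a = b + 2k`. [cite: DeligneHodgeII1971, 2.1.13–2.1.14] -/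
theorem HodgeModel.piece_tateTwist_cast_sub (hY : Motives.IsSmoothProjective m Y) (B : HodgeModel m Y)
    (hB : B.IsHodgeSymmetric) {a b k : ℕ} (hw : ((b : ℕ) : ℤ) - 2 * (-((k : ℕ) : ℤ)) = ((a : ℕ) : ℤ)) (p q : ℤ) :
    (((B.hodgeStructure hY hB b).tateTwist (-((k : ℕ) : ℤ))).cast hw).piece p q =
      (B.hodgeStructure hY hB b).piece (p - k) (q - k) := by
  rw [HodgeModel.piece_tateTwist_cast_int, sub_eq_add_neg, sub_eq_add_neg]

/-! ### §5 Difference type `(c − n, c − n)` for naturals `c`, `n` -/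

/-- **A rational map of type `(c − l, c − l)` (`c`, `l` naturals, any order) on the carriers — type `(p, q) ↦ (p', q')` for `p' + l = p + c`, `q' + l = q + c`, the types with `p + c < l` or
`q + c < l` killed (the binder shape of the tree's correspondence-action lemmas, `l = dim Z`) — is a morphism `A.hodgeStructure a ⟶ (B.hodgeStructure b)(c − l)`**, `a + 2c = b + 2l` (§1 with
`r = c − l`). [cite: VoisinHodgeI2002, §7.3.1 Def. 7.22 and §7.3.2] [cite: DeligneHodgeII1971, 2.1.13–2.1.14] -/
theorem HodgeModel.exists_hom_of_typeShift_of_add_eq (hX : Motives.IsSmoothProjective n X)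
    (hY : Motives.IsSmoothProjective m Y) (A : HodgeModel n X) (hA : A.IsHodgeSymmetric)
    (B : HodgeModel m Y) (hB : B.IsHodgeSymmetric) {a b c l : ℕ} (hab : a + 2 * c = b + 2 * l)
    (T : Motives.HodgeStructure (Motives.bettiCohomology Y b) ((a : ℕ) : ℤ))
    (hT : ∀ p q : ℤ, T.piece p q = (B.hodgeStructure hY hB b).piece (p + c - l) (q + c - l))
    (f : complexBetti X a →ₗ[ℂ] complexBetti Y b) (hf : ∀ u, IsRationalClass u → IsRationalClass (f u))
    (hfH : ∀ (p q : ℕ), p + q = a → ∀ u, A.pullback a u ∈ A.hodgePQ a p q →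
      ∀ p' q' : ℕ, p' + l = p + c → q' + l = q + c → B.pullback b (f u) ∈ B.hodgePQ b p' q')
    (hf0 : ∀ (p q : ℕ), p + q = a → ∀ u, A.pullback a u ∈ A.hodgePQ a p q → p + c < l ∨ q + c < l → f u = 0) :
    ∃ φ : Motives.HodgeStructure.Hom (A.hodgeStructure hX hA a) T,
      ∀ x, Motives.ofRatClassBaseChange (Motives.ComplexPoints Y) b (φ.toLinearMap.baseChange ℂ x) =
        f (Motives.ofRatClassBaseChange (Motives.ComplexPoints X) a x) :=
  HodgeModel.exists_hom_of_typeShift_int hX hY A hA B hB (r := ((c : ℕ) : ℤ) - ((l : ℕ) : ℤ)) (by omega) T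
    (fun p q ↦ by rw [hT]; congr 1 <;> omega) f hf
    (fun p q hpq u hu p' q' hp' hq' ↦ hfH p q hpq u hu p' q' (by omega) (by omega))
    (fun p q hpq u hu hlt ↦ hf0 p q hpq u hu (by omega))

/-- **Conversely a morphism `A.hodgeStructure a ⟶ (B.hodgeStructure b)(c − l)` is a rational map of type `(c − l, c − l)` on the carriers in the binder shape `p' + l = p + c`, killing the types
with `p + c < l` or `q + c < l`** (§2 with `r = c − l`). [cite: VoisinHodgeI2002, §7.3.1 Def. 7.22 and §7.3.2] [cite: DeligneHodgeII1971, 1.2.5, 2.1.13–2.1.14] -/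
theorem HodgeModel.typeShift_of_hom_of_add_eq (hX : Motives.IsSmoothProjective n X)
    (hY : Motives.IsSmoothProjective m Y) (A : HodgeModel n X) (hA : A.IsHodgeSymmetric)
    (B : HodgeModel m Y) (hB : B.IsHodgeSymmetric) {a b c l : ℕ} (hab : a + 2 * c = b + 2 * l)
    (T : Motives.HodgeStructure (Motives.bettiCohomology Y b) ((a : ℕ) : ℤ))
    (hT : ∀ p q : ℤ, T.piece p q = (B.hodgeStructure hY hB b).piece (p + c - l) (q + c - l))
    (φ : Motives.HodgeStructure.Hom (A.hodgeStructure hX hA a) T)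
    (f : complexBetti X a →ₗ[ℂ] complexBetti Y b)
    (hf : ∀ x, Motives.ofRatClassBaseChange (Motives.ComplexPoints Y) b (φ.toLinearMap.baseChange ℂ x) =
      f (Motives.ofRatClassBaseChange (Motives.ComplexPoints X) a x)) :
    (∀ u, IsRationalClass u → IsRationalClass (f u)) ∧
      (∀ (p q : ℕ), p + q = a → ∀ u, A.pullback a u ∈ A.hodgePQ a p q →
        ∀ p' q' : ℕ, p' + l = p + c → q' + l = q + c → B.pullback b (f u) ∈ B.hodgePQ b p' q') ∧
      (∀ (p q : ℕ), p + q = a → ∀ u, A.pullback a u ∈ A.hodgePQ a p q → p + c < l ∨ q + c < l → f u = 0) := by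
  obtain ⟨hR, hS, hV⟩ := HodgeModel.typeShift_of_hom_int hX hY A hA B hB (r := ((c : ℕ) : ℤ) - ((l : ℕ) : ℤ)) (by omega) T
    (fun p q ↦ by rw [hT]; congr 1 <;> omega) φ f hf
  exact ⟨hR, fun p q hpq u hu p' q' hp' hq' ↦ hS p q hpq u hu p' q' (by omega) (by omega),
    fun p q hpq u hu hlt ↦ hV p q hpq u hu (by omega)⟩

/-- The carrier map of a morphism `A.hodgeStructure a ⟶ (B.hodgeStructure b)(c − l)` packaged in the binder shape `p' + l = p + c` (§2 with `r = c − l`). [cite: VoisinHodgeI2002, §7.3.2] -/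
theorem HodgeModel.exists_carrier_of_hom_of_add_eq (hX : Motives.IsSmoothProjective n X)
    (hY : Motives.IsSmoothProjective m Y) (A : HodgeModel n X) (hA : A.IsHodgeSymmetric)
    (B : HodgeModel m Y) (hB : B.IsHodgeSymmetric) {a b c l : ℕ} (hab : a + 2 * c = b + 2 * l)
    (T : Motives.HodgeStructure (Motives.bettiCohomology Y b) ((a : ℕ) : ℤ))
    (hT : ∀ p q : ℤ, T.piece p q = (B.hodgeStructure hY hB b).piece (p + c - l) (q + c - l))
    (φ : Motives.HodgeStructure.Hom (A.hodgeStructure hX hA a) T) :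
    ∃ f : complexBetti X a →ₗ[ℂ] complexBetti Y b,
      (∀ x, Motives.ofRatClassBaseChange (Motives.ComplexPoints Y) b (φ.toLinearMap.baseChange ℂ x) =
        f (Motives.ofRatClassBaseChange (Motives.ComplexPoints X) a x)) ∧
      (∀ u, IsRationalClass u → IsRationalClass (f u)) ∧
      (∀ (p q : ℕ), p + q = a → ∀ u, A.pullback a u ∈ A.hodgePQ a p q →
        ∀ p' q' : ℕ, p' + l = p + c → q' + l = q + c → B.pullback b (f u) ∈ B.hodgePQ b p' q') ∧
      (∀ (p q : ℕ), p + q = a → ∀ u, A.pullback a u ∈ A.hodgePQ a p q → p + c < l ∨ q + c < l → f u = 0) := by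
  obtain ⟨f, hf, -⟩ := HodgeModel.exists_carrier_of_hom_int hX hY A hA B hB (r := ((c : ℕ) : ℤ) - ((l : ℕ) : ℤ)) (by omega) T
    (fun p q ↦ by rw [hT]; congr 1 <;> omega) φ
  exact ⟨f, hf, HodgeModel.typeShift_of_hom_of_add_eq hX hY A hA B hB hab T hT φ f hf⟩

/-- The pieces of `(B.hodgeStructure hY hB b)(c − l)` transported to weight `a`, `a + 2c = b + 2l`, in the binder shape of §5. [cite: DeligneHodgeII1971, 2.1.13–2.1.14] -/
theorem HodgeModel.piece_tateTwist_cast_of_add_eq (hY : Motives.IsSmoothProjective m Y) (B : HodgeModel m Y)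
    (hB : B.IsHodgeSymmetric) {a b c l : ℕ} (hw : ((b : ℕ) : ℤ) - 2 * (((c : ℕ) : ℤ) - ((l : ℕ) : ℤ)) = ((a : ℕ) : ℤ)) (p q : ℤ) :
    (((B.hodgeStructure hY hB b).tateTwist (((c : ℕ) : ℤ) - ((l : ℕ) : ℤ))).cast hw).piece p q =
      (B.hodgeStructure hY hB b).piece (p + c - l) (q + c - l) := by
  rw [HodgeModel.piece_tateTwist_cast_int, add_sub_assoc, add_sub_assoc]

end HodgeTheory

end Literature.AlgebraicGeometry.HodgeTheory

end
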